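import Literature.AlgebraicGeometry.HodgeTheory.HarmonicFiltrationKernel
import Literature.AlgebraicGeometry.Motives.HodgeDecompositionIsInternalDischarge
import Mathlib.LinearAlgebra.DFinsupp
import HarnessLib

/-!
# The harmonic representative as a linear map, and the operator `c ↦ Π^{<p} η_c`

Topic: Hodge theory of compact Kähler manifolds (Voisin (2002), §5.3.1, §6.1.3). Theorems only,
no new facts (the linear maps are produced existentially).

On a compact Kähler manifold `(M, g, o)`:

* `exists_harmonicRep_linearMap` — the `Δ_d`-harmonic representative `η_c` of a class
  `c ∈ H^k_dR(M; ℂ)` (Voisin, Thm. 5.23) depends LINEARLY on `c` (uniqueness), giving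
  `hr : H^k_dR(M; ℂ) →ₗ[ℂ] Z^k(M; ℂ)` with `[hr c] = c`, `hr c` harmonic, and every harmonic
  representative of `c` equal to `hr c`; together with the operator
  `Λ : H^k_dR(M; ℂ) →ₗ[ℂ] A^k(M; ℂ)`, `Λ c = Π^{<p} η_c = ∑_{r+s=k, r<p} η_c^{r,s}` into the `L²`
  pre-Hilbert space `CL2SmoothForms o k`, whose KERNEL is the Hodge filtration
  `F^p = ⨆_{r ≥ p} K^{r,s}` (`mem_hodgeFiltration_iff_typeComponent_eq_zero`).
* `finrank_biSup_eq_sum_of_iSupIndep`, `finrank_biSup_hodgePQ_eq_sum` — `dim F^p = ∑_{r ≥ p}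
  dim K^{r,s}` (independence of the `K^{r,s}`, the Hodge decomposition).

These are the fibrewise ingredients of the continuity-and-kernel description of the Hodge bundles
in a family (Voisin, §10.2.2).

## References

* C. Voisin, *Hodge Theory and Complex Algebraic Geometry I*, CUP (2002), §5.3.1 Thm. 5.23,
  §6.1.3 Prop. 6.11, §7.1.1. [VoisinHodgeI2002]
-/

noncomputable section

open scoped Manifold ContDiff Topology
open Bundle Module Set Finset

namespace Literature.AlgebraicGeometry.HodgeTheory

open Literature.Geometry.Kaehler Literature.NumberTheory.Transcendental
  Literature.AlgebraicGeometry.Motives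

/-! ### Linear algebra: dimension of a partial sum of independent subspaces -/

/-- For an independent family of subspaces of a finite-dimensional space,
`dim (⨆_{i ∈ s} p i) = ∑_{i ∈ s} dim (p i)`. [folklore] -/
theorem finrank_biSup_eq_sum_of_iSupIndep {K V : Type*} [Field K] [AddCommGroup V]
    [Module K V] [FiniteDimensional K V] {ι : Type*} (s : Finset ι)
    (p : ι → Submodule K V) (hind : iSupIndep p) :
    finrank K ↥(⨆ i ∈ s, p i) = ∑ i ∈ s, finrank K ↥(p i) := by
  classical
  -- the subfamily indexed by `s`
  let q : ↥s → Submodule K V := fun i ↦ p i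
  have hqind : iSupIndep q := hind.comp Subtype.val_injective
  have hsup : (⨆ i ∈ s, p i) = ⨆ i : ↥s, q i := (iSup_subtype'' (↑s : Set ι) p).symm
  -- `⨆ q = range (lsum)`, an injective map from `Π₀ i : s, p i`
  set f := DFinsupp.lsum ℕ (M := fun i : ↥s ↦ ↥(q i)) fun i ↦ (q i).subtype with hf
  have hrange : (⨆ i : ↥s, q i) = LinearMap.range f := Submodule.iSup_eq_range_dfinsupp_lsum q
  have hinj : Function.Injective f := hqind.dfinsupp_lsum_injective
  rw [hsup, hrange, LinearMap.finrank_range_of_inj hinj,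
    (DFinsupp.linearEquivFunOnFintype (R := K) (M := fun i : ↥s ↦ ↥(q i))).finrank_eq,
    Module.finrank_pi_fintype, ← Finset.sum_coe_sort s]

/-! ### The compact Kähler manifold -/

variable {E : Type*} [NormedAddCommGroup E] [NormedSpace ℂ E] [FiniteDimensional ℂ E]
  {M : Type*} [TopologicalSpace M] [ChartedSpace E M] [IsManifold 𝓘(ℝ, E) ∞ M]
  [IsManifold 𝓘(ℂ, E) ω M] [T2Space M] [CompactSpace M] {n : ℕ} [Fact (finrank ℝ E = n)]
  (g : ContMDiffRiemannianMetric 𝓘(ℝ, E) ∞ E (fun x : M ↦ TangentSpace 𝓘(ℝ, E) x))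
  (o : (x : M) → Orientation ℝ (TangentSpace 𝓘(ℝ, E) x) (Fin n))

omit [Fact (finrank ℝ E = n)] in
/-- **`dim (⨆_{(p,q) ∈ P} K^{p,q}) = ∑_{(p,q) ∈ P} dim K^{p,q}`** on a compact Kähler manifold
(independence of the `K^{p,q}`, the Hodge decomposition `directSum_isInternal_hodgePQ`); in
particular `dim F^p = ∑_{r ≥ p} h^{r,k-r}`. [cite: VoisinHodgeI2002, §6.1.3 (p. 142)] -/
theorem finrank_biSup_hodgePQ_eq_sum [IsKaehlerManifold E M] (k : ℕ) (P : ℕ × ℕ → Prop)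
    [DecidablePred P] :
    finrank ℂ ↥(⨆ pq ∈ {pq ∈ antidiagonal k | P pq}, hodgePQ E M k pq.1 pq.2) =
      ∑ pq ∈ {pq ∈ antidiagonal k | P pq}, finrank ℂ ↥(hodgePQ E M k pq.1 pq.2) := by
  classical
  haveI : Module.Finite ℂ (complexDeRhamCohomology E M k) :=
    complexDeRhamCohomology.finite_of_compactSpace E M k
  -- the independent family indexed by the antidiagonal, restricted to the filter
  have hI := directSum_isInternal_hodgePQ (E := E) (M := M) k
  have hind : iSupIndep fun pq : ↥(antidiagonal k) ↦ hodgePQ E M k pq.1.1 pq.1.2 :=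
    hI.submodule_iSupIndep
  set s : Finset ↥(antidiagonal k) := Finset.univ.filter (fun pq ↦ P pq.1) with hs
  have h1 := finrank_biSup_eq_sum_of_iSupIndep s
    (fun pq : ↥(antidiagonal k) ↦ hodgePQ E M k pq.1.1 pq.1.2) hind
  -- identify both sides
  have hsup : (⨆ pq ∈ {pq ∈ antidiagonal k | P pq}, hodgePQ E M k pq.1 pq.2) =
      ⨆ pq ∈ s, hodgePQ E M k pq.1.1 pq.1.2 := by
    apply le_antisymm
    · refine iSup₂_le fun pq hpq ↦ ?_
      obtain ⟨hA, hP⟩ := Finset.mem_filter.1 hpq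
      exact le_iSup₂_of_le (⟨pq, hA⟩ : ↥(antidiagonal k)) (by simp [hs, hP]) le_rfl
    · refine iSup₂_le fun pq hpq ↦ ?_
      have hP : P pq.1 := (Finset.mem_filter.1 hpq).2
      exact le_iSup₂_of_le pq.1 (Finset.mem_filter.2 ⟨pq.2, hP⟩) le_rfl
  have hsum : ∑ pq ∈ s, finrank ℂ ↥(hodgePQ E M k pq.1.1 pq.1.2) =
      ∑ pq ∈ {pq ∈ antidiagonal k | P pq}, finrank ℂ ↥(hodgePQ E M k pq.1 pq.2) := by
    rw [hs, Finset.sum_filter, Finset.sum_filter]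
    exact Finset.sum_coe_sort (antidiagonal k)
      (fun pq ↦ if P pq then finrank ℂ ↥(hodgePQ E M k pq.1 pq.2) else 0)
  rw [hsup, h1, hsum]

set_option maxHeartbeats 400000 in
/-- **The harmonic representative is linear in the class, and `c ↦ Π^{<p} η_c` cuts out `F^p`.**
On a compact Kähler manifold `(M, g, o)` (holomorphic atlas, `vol_o` smooth), for `k + m = n` and
`p`, there are `ℂ`-linear maps `hr : H^k_dR(M; ℂ) → Z^k(M; ℂ)` and
`Λ : H^k_dR(M; ℂ) → (A^k(M; ℂ), ‖·‖_{L²})` such that: `hr c` is the `Δ_d`-harmonic representative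
of `c` (Voisin, Thm. 5.23: harmonic, `[hr c] = c`, and unique); `Λ c = ∑_{r+s=k, r<p} (hr c)^{r,s}`;
and `Λ c = 0 ↔ c ∈ F^pH^k = ⨆_{r+s=k, p ≤ r} K^{r,s}` (Prop. 6.11 / §7.1.1).
[cite: VoisinHodgeI2002, §5.3.1 Thm. 5.23, §6.1.3 Prop. 6.11] -/
theorem exists_harmonicRep_linearMap [MeasurableSpace E] [BorelSpace E]
    (hg : g.toRiemannianMetric.IsKaehler) {k m : ℕ} (h : k + m = n) (p : ℕ) :
    letI : RiemannianBundle (fun x : M ↦ TangentSpace 𝓘(ℝ, E) x) := ⟨g.toRiemannianMetric⟩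
    haveI : IsContMDiffRiemannianBundle 𝓘(ℝ, E) ∞ E (fun x : M ↦ TangentSpace 𝓘(ℝ, E) x) :=
      ⟨g.inner, g.contMDiff, fun _ _ _ ↦ rfl⟩
    ∀ (ho : IsSmoothForm (riemannianVolumeForm o)),
      haveI : Fact (IsSmoothForm (riemannianVolumeForm o)) := ⟨ho⟩
      ∃ (hr : complexDeRhamCohomology E M k →ₗ[ℂ] ↥(cclosedSmoothForms E M k))
        (Λ : complexDeRhamCohomology E M k →ₗ[ℂ] CL2SmoothForms o k),
        (∀ c, IsCHarmonicForm o h (hr c : MForm 𝓘(ℝ, E) M ℂ k)) ∧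
        (∀ c, complexDeRhamCohomology.mk E M k (hr c) = c) ∧
        (∀ c (η : cclosedSmoothForms E M k), IsCHarmonicForm o h (η : MForm 𝓘(ℝ, E) M ℂ k) →
          complexDeRhamCohomology.mk E M k η = c → η = hr c) ∧
        (∀ c, CL2SmoothForms.toForm o (Λ c) = ∑ pq ∈ (antidiagonal k).filter (fun pq ↦ pq.1 < p),
          (hr c : MForm 𝓘(ℝ, E) M ℂ k).typeComponent pq.1 pq.2) ∧
        (∀ c, Λ c = 0 ↔ c ∈ ⨆ pq ∈ {pq ∈ antidiagonal k | p ≤ pq.1}, hodgePQ E M k pq.1 pq.2) := by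
  letI : RiemannianBundle (fun x : M ↦ TangentSpace 𝓘(ℝ, E) x) := ⟨g.toRiemannianMetric⟩
  haveI : IsContMDiffRiemannianBundle 𝓘(ℝ, E) ∞ E (fun x : M ↦ TangentSpace 𝓘(ℝ, E) x) :=
    ⟨g.inner, g.contMDiff, fun _ _ _ ↦ rfl⟩
  intro ho
  haveI : Fact (IsSmoothForm (riemannianVolumeForm o)) := ⟨ho⟩
  classical
  have h11 := existsUnique_isHarmonicForm_mk_eq_of_compact_of_isKaehler g o hg k m
  -- the harmonic representative, by choice
  choose hrf hhrf hmk using fun c ↦ exists_isCHarmonicForm_mk_eq o h11 ho h c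
  have huniq : ∀ c (η : cclosedSmoothForms E M k), IsCHarmonicForm o h (η : MForm 𝓘(ℝ, E) M ℂ k) →
      complexDeRhamCohomology.mk E M k η = c → η = hrf c := fun c η hη hηc ↦
    eq_of_isCHarmonicForm_of_mk_eq o ho h hη (hhrf c) (hηc.trans (hmk c).symm)
  -- it is linear
  let hr : complexDeRhamCohomology E M k →ₗ[ℂ] ↥(cclosedSmoothForms E M k) :=
    { toFun := hrf
      map_add' := fun c d ↦ (huniq (c + d) (hrf c + hrf d)
        (by rw [Submodule.coe_add]; exact (hhrf c).add o ho h (hhrf d))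
        (by rw [map_add, hmk, hmk])).symm
      map_smul' := fun a c ↦ (huniq (a • c) (a • hrf c)
        (by rw [Submodule.coe_smul]; exact (hhrf c).smul o h a)
        (by rw [map_smul, hmk])).symm }
  have hr_apply : ∀ c, hr c = hrf c := fun _ ↦ rfl
  -- the operator `Λ c = Π^{<p} (hr c)`
  set S₁ := (antidiagonal k).filter (fun pq ↦ pq.1 < p) with hS₁
  have hsm : ∀ c, IsSmoothForm (∑ pq ∈ S₁, (hrf c : MForm 𝓘(ℝ, E) M ℂ k).typeComponent pq.1 pq.2) :=
    fun c ↦ (smoothForms 𝓘(ℝ, E) M ℂ k).sum_mem fun pq _ ↦ (hhrf c).1.typeComponent pq.1 pq.2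
  have hinj : ∀ a b : CL2SmoothForms o k,
      CL2SmoothForms.toForm o a = CL2SmoothForms.toForm o b → a = b := fun a b hab ↦ Subtype.ext hab
  let Λ : complexDeRhamCohomology E M k →ₗ[ℂ] CL2SmoothForms o k :=
    { toFun := fun c ↦ CL2SmoothForms.mk o _ (hsm c)
      map_add' := fun c d ↦ hinj _ _ (by
        rw [CL2SmoothForms.toForm_add, CL2SmoothForms.toForm_mk, CL2SmoothForms.toForm_mk,
          CL2SmoothForms.toForm_mk, ← Finset.sum_add_distrib]
        refine Finset.sum_congr rfl fun pq _ ↦ ?_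
        rw [← MForm.typeComponent_add, ← Submodule.coe_add, ← hr_apply, map_add]
        rfl)
      map_smul' := fun a c ↦ hinj _ _ (by
        rw [CL2SmoothForms.toForm_smul, CL2SmoothForms.toForm_mk, CL2SmoothForms.toForm_mk,
          Finset.smul_sum, RingHom.id_apply]
        refine Finset.sum_congr rfl fun pq _ ↦ ?_
        rw [← MForm.typeComponent_smul, ← Submodule.coe_smul, ← hr_apply, map_smul]
        rfl) }
  refine ⟨hr, Λ, fun c ↦ hhrf c, fun c ↦ hmk c, huniq, fun c ↦ rfl, fun c ↦ ?_⟩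
  -- the kernel
  have hK : (complexDeRhamCohomology.mk E M k (hrf c) ∈
      ⨆ pq ∈ {pq ∈ antidiagonal k | p ≤ pq.1}, hodgePQ E M k pq.1 pq.2) ↔
        ∀ r s, r < p → (hrf c : MForm 𝓘(ℝ, E) M ℂ k).typeComponent r s = 0 :=
    mem_hodgeFiltration_iff_typeComponent_eq_zero g o hg h p ho (hrf c) (hhrf c)
  rw [hmk c] at hK
  refine Iff.trans ?_ hK.symm
  have hΛc : CL2SmoothForms.toForm o (Λ c) =
      ∑ pq ∈ S₁, (hrf c : MForm 𝓘(ℝ, E) M ℂ k).typeComponent pq.1 pq.2 := rfl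
  constructor
  · intro hΛ r s hrs
    -- `(Λ c)^{r,s} = (hr c)^{r,s}` for `r < p`, `r + s = k`
    by_cases hk : r + s = k
    swap
    · exact MForm.typeComponent_of_ne hk _
    have hΛ' : ∑ pq ∈ S₁, (hrf c : MForm 𝓘(ℝ, E) M ℂ k).typeComponent pq.1 pq.2 = 0 := by
      rw [← hΛc, hΛ, CL2SmoothForms.toForm_zero]
    have hmem : (r, s) ∈ S₁ := Finset.mem_filter.2 ⟨mem_antidiagonal.2 hk, hrs⟩
    -- take the `(r,s)`-component of the vanishing sum
    have hcomp : (∑ pq ∈ S₁, (hrf c : MForm 𝓘(ℝ, E) M ℂ k).typeComponent pq.1 pq.2).typeComponent r s =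
        (hrf c : MForm 𝓘(ℝ, E) M ℂ k).typeComponent r s := by
      have hlin : ∀ (T : Finset (ℕ × ℕ)),
          (∑ pq ∈ T, (hrf c : MForm 𝓘(ℝ, E) M ℂ k).typeComponent pq.1 pq.2).typeComponent r s =
            ∑ pq ∈ T, ((hrf c : MForm 𝓘(ℝ, E) M ℂ k).typeComponent pq.1 pq.2).typeComponent r s := by
        intro T
        induction T using Finset.induction_on with
        | empty => simp [MForm.typeComponent_zero]
        | insert a T ha ih => rw [Finset.sum_insert ha, Finset.sum_insert ha,
            MForm.typeComponent_add, ih]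
      rw [hlin]
      have hterm : ∀ pq ∈ S₁,
          ((hrf c : MForm 𝓘(ℝ, E) M ℂ k).typeComponent pq.1 pq.2).typeComponent r s =
            if pq = (r, s) then (hrf c : MForm 𝓘(ℝ, E) M ℂ k).typeComponent r s else 0 := by
        intro pq hpq
        have hpqk : pq.1 + pq.2 = k := mem_antidiagonal.1 (Finset.mem_filter.1 hpq).1
        have htype : IsOfType pq.1 pq.2 ((hrf c : MForm 𝓘(ℝ, E) M ℂ k).typeComponent pq.1 pq.2) :=
          isOfType_typeComponent_holds hpqk _
        split_ifs with hpp
        · subst hpp; exact htype.typeComponent_eq_self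
        · refine IsOfType.typeComponent_of_ne_holds htype ?_
          by_contra hcon
          push Not at hcon
          exact hpp (Prod.ext hcon.1 hcon.2)
      rw [Finset.sum_congr rfl hterm, Finset.sum_ite_eq' S₁ (r, s), if_pos hmem]
    rw [← hcomp, hΛ', MForm.typeComponent_zero]
  · intro hzero
    apply hinj
    rw [hΛc, CL2SmoothForms.toForm_zero]
    exact Finset.sum_eq_zero fun pq hpq ↦ hzero pq.1 pq.2 (Finset.mem_filter.1 hpq).2

end Literature.AlgebraicGeometry.HodgeTheory
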